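import Literature.AlgebraicGeometry.Resolution.BranchChartLift
import Literature.AlgebraicGeometry.Resolution.PointBlowupOrderChart
import Literature.AlgebraicGeometry.Resolution.SymbolicPowersRegularQuotient
import Literature.AlgebraicGeometry.Resolution.BlowupChartRegular
import Literature.AlgebraicGeometry.Resolution.RegularSystemOfParameters
import Mathlib.RingTheory.Noetherian.Basic
import Mathlib.RingTheory.Localization.FractionRing
import HarnessLib

/-!
# The order of an ideal along a branch of a curve is at most its order at the point

Topic: `Literature/AlgebraicGeometry/Resolution`. Let `(R, 𝔪)` be a regular local ring and let
`f : R → W` be a **branch through the closed point**: a local homomorphism to a discrete valuation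
ring `W`, finite (`W` is a finitely generated `R`-module) and birational onto its image (every
element of `W` is a quotient `f(a)/f(b)`). Let `P = ker f` (a prime with `dim R/P = 1`) and let `S`
be the localisation of `R` at `P`. **Theorem** (`mem_pow_of_algebraMap_mem_pow_of_branch`): if
`x ∈ R` has `x/1 ∈ (P S)^n` then `x ∈ 𝔪^n`; for ideals: `J S ⊆ (PS)^n ⇒ J ⊆ 𝔪^n`
(`le_pow_of_map_le_pow_of_branch`). In words: the order of `J` at the generic point of the curve
`V(P)` does not exceed its order at the closed point — the pointwise content of "`x ↦ ord_x J` is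
upper semicontinuous", which Cossart–Piltant use in the proof of Prop. 4.2 of [CoP1]
("`Σ := {x ∈ X | m(x) = μ}` … is a closed subset of `X`") and which, for regular local rings, is the
local form of Zariski's theorem on symbolic powers (`P^{(n)} ⊆ 𝔪^n`).

## Proof (embedded resolution of the branch by point blow-ups)

Noetherian induction on the `R`-submodule `f'(R') ⊆ W` over all factorizations `R → R' → W` of the
branch through regular local rings `R'` (`W` is a Noetherian `R`-module). If `f'` is surjective,
`R'/ker f' ≅ W` is regular and the claim is `SymbolicPowersRegularQuotient.lean` (for `R'/P'`
regular, `P'^{(n)} = P'^n ⊆ 𝔪'^n`). Otherwise choose a regular system of parameters `c` of `R'` and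
`j` with `v(f' c_j)` minimal; by the surjectivity criterion (`BranchChartLift.lean`) some quotient
`q_l = f'(c_l)/f'(c_j)` is not in `f'(R')`. Lift `f'` to the chart `B_j = (R'[𝔪't])_{(c_j t)}` of the
blowing up of the closed point (`exists_ringHom_chartRing`), localise at the centre `𝔴` of `W` on
`B_j`: `R₁ = (B_j)_𝔴` is again a regular local ring (`isRegularRing_blowupChart`), `f₁ : R₁ → W`
is a branch with strictly larger image (it contains `q_l`), and `S` is still the localisation of
`R₁` at `ker f₁` (the blow-up is an isomorphism at `P`). If `x ∉ 𝔪'^n`, say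
`x ∈ 𝔪'^ν ∖ 𝔪'^{ν+1}` with `ν < n`, the weak transform `x' ∈ R₁` of `x` (`φ x = φ(c_j)^ν x'`) has
`x' ∉ 𝔪₁^{ν+1}` by the key lemma on point blow-ups (`exists_weakTransform_chart_not_mem_pow`,
[CoP1] (11)), while `x'/1 = x/c_j^ν ∈ (PS)^n` gives `x' ∈ 𝔪₁^n ⊆ 𝔪₁^{ν+1}` by induction — a
contradiction.

## References

* V. Cossart, O. Piltant, J. Algebra 320 (2008), proof of Prop. 4.2 (p. 1059 of the journal = p. 7
  of the held author version: `Σ` closed; (10)–(11) and (a): order under point blow-ups).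
  [cite: CossartPiltant2008, Prop. 4.2 (proof)]
* K. Kiyek, J. L. Vicente, *Resolution of Curve and Surface Singularities* (2004), Ch. II §4
  (blowing up one-dimensional local rings along a discrete valuation; (4.4): the blow-up is trivial
  iff the ring is regular). [cite: KiyekVicente2004, Ch. II (4.1)–(4.4)]
-/

noncomputable section

open IsLocalRing

namespace Literature.AlgebraicGeometry.Resolution

universe u v w

section Branch

variable {R : Type u} [CommRing R] [IsRegularLocalRing R]
  {W : Type v} [CommRing W] [IsDomain W] [IsDiscreteValuationRing W]

omit [IsRegularLocalRing R] [IsDomain W] [IsDiscreteValuationRing W] in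
/-- A birational map onto its image stays birational after enlarging the source. [folklore] -/
theorem birational_of_comp {R' : Type*} [CommRing R'] {f : R →+* W} {f' : R' →+* W}
    {φ₀ : R →+* R'} (h : f'.comp φ₀ = f)
    (hbir : ∀ w : W, ∃ a b : R, f b ≠ 0 ∧ w * f b = f a) :
    ∀ w : W, ∃ a b : R', f' b ≠ 0 ∧ w * f' b = f' a := fun w => by
  obtain ⟨a, b, hb, hab⟩ := hbir w
  refine ⟨φ₀ a, φ₀ b, ?_, ?_⟩
  · rwa [← RingHom.comp_apply, h]
  · rw [← RingHom.comp_apply, ← RingHom.comp_apply, h]; exact hab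

omit [IsDomain W] [IsDiscreteValuationRing W] in
/-- If a branch `f' : R' → W` (local, birational onto its image) kills a generating set of `𝔪'`,
it is surjective (then `𝔪' = ker f'` and `W` would be a field; used contrapositively to find a
parameter with `f'(c_l) ≠ 0`). [folklore] -/
theorem surjective_of_forall_map_eq_zero {R' : Type*} [CommRing R'] [IsLocalRing R']
    (f' : R' →+* W) {d : ℕ} {c : Fin d → R'} (hc : Ideal.span (Set.range c) = maximalIdeal R')
    (h0 : ∀ l, f' (c l) = 0) (hbir : ∀ w : W, ∃ a b : R', f' b ≠ 0 ∧ w * f' b = f' a) :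
    Function.Surjective f' := by
  intro w
  obtain ⟨a, b, hb, hab⟩ := hbir w
  have hbu : IsUnit b := by
    by_contra hbu
    have hbm : b ∈ Ideal.span (Set.range c) := by rw [hc]; exact hbu
    have hle : Ideal.span (Set.range c) ≤ RingHom.ker f' := by
      rw [Ideal.span_le]; rintro _ ⟨l, rfl⟩; exact h0 l
    exact hb (hle hbm)
  refine ⟨a * ↑(hbu.unit⁻¹), ?_⟩
  have hfb : IsUnit (f' b) := hbu.map f'
  calc f' (a * ↑(hbu.unit⁻¹)) = f' a * f' ↑(hbu.unit⁻¹) := map_mul _ _ _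
    _ = w * f' b * f' ↑(hbu.unit⁻¹) := by rw [hab]
    _ = w * f' (b * ↑(hbu.unit⁻¹)) := by rw [mul_assoc, ← map_mul]
    _ = w := by rw [IsUnit.mul_val_inv, map_one, mul_one]

omit [IsDomain W] [IsDiscreteValuationRing W] in
/-- The branch on the local ring of the chart at the centre of `W`: for `g : B → W` and
`𝔴 = g⁻¹(𝔪_W)`, the induced `f₁ : B_𝔴 → W` is a local homomorphism extending `g`. [folklore] -/
theorem exists_localHom_localization_comap {B : Type*} [CommRing B] [IsLocalRing W] (g : B →+* W)
    (𝔴 : Ideal B) [𝔴.IsPrime] (h𝔴 : 𝔴 = (maximalIdeal W).comap g) :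
    ∃ f₁ : Localization.AtPrime 𝔴 →+* W, IsLocalHom f₁ ∧ ∀ b, f₁ (algebraMap B _ b) = g b := by
  have hmem : ∀ b, b ∈ 𝔴 ↔ g b ∈ maximalIdeal W := fun b => by rw [h𝔴, Ideal.mem_comap]
  have hunits : ∀ s : 𝔴.primeCompl, IsUnit (g s) := fun s =>
    not_not.mp fun h => s.2 ((hmem s).mpr (mem_nonunits_iff.mpr h))
  refine ⟨IsLocalization.lift (M := 𝔴.primeCompl) (S := Localization.AtPrime 𝔴) (g := g) hunits,
    ⟨fun z hz => ?_⟩, fun b => IsLocalization.lift_eq hunits b⟩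
  obtain ⟨⟨b, s⟩, hbs⟩ := IsLocalization.surj 𝔴.primeCompl z
  have h1 : IsLocalization.lift (M := 𝔴.primeCompl) (S := Localization.AtPrime 𝔴) (g := g) hunits
      z * g s = g b := by
    rw [← IsLocalization.lift_eq (M := 𝔴.primeCompl) (S := Localization.AtPrime 𝔴) hunits (s : B),
      ← map_mul, hbs, IsLocalization.lift_eq]
  have hgb : IsUnit (g b) := by rw [← h1]; exact hz.mul (hunits s)
  have hb : b ∈ 𝔴.primeCompl := fun hb => (mem_nonunits_iff.mp ((hmem b).mp hb)) hgb
  have hzs : IsUnit (z * algebraMap B (Localization.AtPrime 𝔴) s) := by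
    rw [hbs]; exact IsLocalization.map_units (Localization.AtPrime 𝔴) ⟨b, hb⟩
  exact isUnit_of_mul_isUnit_left hzs

omit [IsDomain W] [IsDiscreteValuationRing W] in
/-- **The blow-up is an isomorphism at the generic point of the branch.** Abstract form: let
`g : B → W` (`B` a domain, `W` local domain), `𝔴 = g⁻¹(𝔪_W)`, `f₁ : B_𝔴 → W` the extension of
`g`; let `h : B → S'` be injective into a local ring `S'`, with `h(b)` a unit whenever `g(b) ≠ 0`,
and such that every element of `S'` is a fraction `h(r)/h(t)` with `g(t) ≠ 0`. Then `h` extends to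
`h₁ : B_𝔴 → S'` exhibiting `S'` as the localisation of `B_𝔴` at `P₁ = ker f₁`. [folklore] -/
theorem exists_isLocalization_of_chart {B : Type*} [CommRing B] [IsDomain B] [IsLocalRing W]
    {S' : Type*} [CommRing S'] [IsLocalRing S'] (g : B →+* W) (𝔴 : Ideal B) [𝔴.IsPrime]
    (h𝔴 : 𝔴 = (maximalIdeal W).comap g) (f₁ : Localization.AtPrime 𝔴 →+* W)
    (hf₁ : ∀ b, f₁ (algebraMap B _ b) = g b) (h : B →+* S') (hinj : Function.Injective h)
    (hhu : ∀ b, g b ≠ 0 → IsUnit (h b)) (hsurj : ∀ z : S', ∃ r t : B, g t ≠ 0 ∧ z * h t = h r)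
    (P₁ : Ideal (Localization.AtPrime 𝔴)) [P₁.IsPrime] (hP₁ : RingHom.ker f₁ = P₁) :
    ∃ h₁ : Localization.AtPrime 𝔴 →+* S', (∀ b, h₁ (algebraMap B _ b) = h b) ∧
      @IsLocalization _ _ P₁.primeCompl S' _ h₁.toAlgebra := by
  have hmem : ∀ b, b ∈ 𝔴 ↔ g b ∈ maximalIdeal W := fun b => by rw [h𝔴, Ideal.mem_comap]
  have hunitsg : ∀ s : 𝔴.primeCompl, IsUnit (g s) := fun s =>
    not_not.mp fun h => s.2 ((hmem s).mpr (mem_nonunits_iff.mpr h))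
  have hunits : ∀ s : 𝔴.primeCompl, IsUnit (h s) := fun s => hhu s (hunitsg s).ne_zero
  obtain ⟨h₁, hh₁⟩ : ∃ h₁ : Localization.AtPrime 𝔴 →+* S',
      h₁ = IsLocalization.lift (M := 𝔴.primeCompl) (S := Localization.AtPrime 𝔴) (g := h) hunits :=
    ⟨_, rfl⟩
  have hh₁a : ∀ b, h₁ (algebraMap B _ b) = h b := fun b => by
    rw [hh₁]; exact IsLocalization.lift_eq hunits b
  have hh₁inj : Function.Injective h₁ := by
    rw [hh₁, IsLocalization.lift_injective_iff]
    intro a b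
    rw [hinj.eq_iff, (IsLocalization.injective (M := 𝔴.primeCompl) (Localization.AtPrime 𝔴)
      (Ideal.primeCompl_le_nonZeroDivisors 𝔴)).eq_iff]
  refine ⟨h₁, hh₁a, ?_⟩
  letI : Algebra (Localization.AtPrime 𝔴) S' := h₁.toAlgebra
  have halg : ∀ z, algebraMap (Localization.AtPrime 𝔴) S' z = h₁ z := fun z => rfl
  rw [isLocalization_iff]
  refine ⟨?_, ?_, ?_⟩
  · rintro ⟨z, hz⟩
    obtain ⟨⟨b, s⟩, hbs⟩ := IsLocalization.surj 𝔴.primeCompl z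
    have h1 : f₁ z * g s = g b := by rw [← hf₁ s, ← map_mul, hbs, hf₁]
    have hgb : g b ≠ 0 := by
      intro h0
      apply hz
      change z ∈ P₁
      rw [← hP₁, RingHom.mem_ker]
      rw [h0] at h1
      exact (hunitsg s).mul_left_eq_zero.mp h1
    have h2 : h₁ z * h s = h b := by rw [← hh₁a s, ← map_mul, hbs, hh₁a]
    rw [halg]
    exact isUnit_of_mul_isUnit_left (h2 ▸ hhu b hgb)
  · intro z
    obtain ⟨r, t, ht, hz⟩ := hsurj z
    have ht' : algebraMap B (Localization.AtPrime 𝔴) t ∉ P₁ := by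
      rw [← hP₁, RingHom.mem_ker, hf₁]; exact ht
    refine ⟨⟨algebraMap B _ r, ⟨_, ht'⟩⟩, ?_⟩
    rw [halg, halg, hh₁a, hh₁a]
    exact hz
  · intro a b hab
    exact ⟨1, by rw [hh₁inj hab]⟩

omit [IsRegularLocalRing R] [IsDomain W] [IsDiscreteValuationRing W] in
/-- Two chart lifts through over-rings agree after comparison: if `ι ∘ g` and `h` are the lifts of
`ι ∘ f` and `f_S` to the chart ring through `R[1/c_j]` (`exists_ringHom_chartRing`) and
`σ ∘ f_S = ι ∘ f`, then `σ ∘ h = ι ∘ g`. [folklore] -/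
theorem comp_eq_of_chartLift {n : ℕ} (c : Fin n → R) (j : Fin n) {C C' D : Type*} [CommRing C]
    [CommRing C'] [CommRing D] {f : R →+* C} {fS : R →+* C'} (g : chartRing c j →+* C)
    (h : chartRing c j →+* C') (ι : C →+* D) (σ : C' →+* D) (hu : IsUnit ((ι.comp f) (c j)))
    (huS : IsUnit (((RingHom.id C').comp fS) (c j)))
    (hg : ι.comp g = (IsLocalization.Away.lift (c j) hu).comp
      (reesChart (c j) (Ideal.mem_span_range_self (f := c) (x := j))))
    (hh : (RingHom.id C').comp h = (IsLocalization.Away.lift (c j) huS).comp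
      (reesChart (c j) (Ideal.mem_span_range_self (f := c) (x := j))))
    (hσ : σ.comp fS = ι.comp f) : σ.comp h = ι.comp g := by
  have h1 : h = (IsLocalization.Away.lift (c j) huS).comp
      (reesChart (c j) (Ideal.mem_span_range_self (f := c) (x := j))) := by
    rw [← hh, RingHom.id_comp]
  rw [h1, hg, ← RingHom.comp_assoc]
  congr 1
  apply IsLocalization.ringHom_ext (Submonoid.powers (c j)) (S := Localization.Away (c j))
  rw [RingHom.comp_assoc, IsLocalization.Away.lift_comp, IsLocalization.Away.lift_comp,
    RingHom.id_comp, hσ]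

omit [IsRegularLocalRing R] [IsDomain W] [IsDiscreteValuationRing W] in
/-- The chart lift of an injective map of a domain inverting `c_j ≠ 0` is injective (the chart
ring embeds into `R[1/c_j]`). [folklore] -/
theorem chartLift_injective [IsDomain R] {n : ℕ} (c : Fin n → R) (j : Fin n) (hcj : c j ≠ 0)
    {C' : Type*} [CommRing C'] {fS : R →+* C'} (hfS : Function.Injective fS)
    (h : chartRing c j →+* C') (huS : IsUnit (((RingHom.id C').comp fS) (c j)))
    (hh : (RingHom.id C').comp h = (IsLocalization.Away.lift (c j) huS).comp
      (reesChart (c j) (Ideal.mem_span_range_self (f := c) (x := j)))) :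
    Function.Injective h := by
  have h1 : h = (IsLocalization.Away.lift (c j) huS).comp
      (reesChart (c j) (Ideal.mem_span_range_self (f := c) (x := j))) := by
    rw [← hh, RingHom.id_comp]
  have hψ : Function.Injective (reesChart (c j) (Ideal.mem_span_range_self (f := c) (x := j))) := by
    letI := (reesChart (c j) (Ideal.mem_span_range_self (f := c) (x := j))).toAlgebra
    haveI := isLocalization_reesChart (c j) (Ideal.mem_span_range_self (f := c) (x := j))
    exact IsLocalization.injective
      (M := Submonoid.powers (reesChartBase (c j) (Ideal.mem_span_range_self (f := c) (x := j)) (c j)))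
      (Localization.Away (c j)) (Submonoid.powers_le.mpr (reesChartBase_mem_nonZeroDivisors (c j) _))
  rw [h1, RingHom.coe_comp]
  refine Function.Injective.comp ?_ hψ
  rw [IsLocalization.Away.lift, IsLocalization.lift_injective_iff]
  intro a b
  have hinj1 : Function.Injective (algebraMap R (Localization.Away (c j))) :=
    IsLocalization.injective (M := Submonoid.powers (c j)) (Localization.Away (c j))
      (powers_le_nonZeroDivisors_of_noZeroDivisors hcj)
  change _ ↔ fS a = fS b
  rw [hinj1.eq_iff, hfS.eq_iff]

-- The induction step builds a dozen ring homomorphisms (chart, lift, comparison maps); the whole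
-- tactic block needs about twice the default heartbeat budget.
set_option maxHeartbeats 400000 in
/-- **The order along a branch is at most the order at the point** (element form). Let `R` be a
regular local ring, `W` a discrete valuation ring, `f : R → W` a local homomorphism which is
finite and birational onto its image, `S` a localisation of `R` at the prime `P = ker f`. If
`x/1 ∈ (PS)^n` then `x ∈ 𝔪^n`. [cite: CossartPiltant2008, Prop. 4.2 (proof)] -/
theorem mem_pow_of_algebraMap_mem_pow_of_branch (f : R →+* W) [IsLocalHom f] (hfin : f.Finite)
    (hbir : ∀ w : W, ∃ a b : R, f b ≠ 0 ∧ w * f b = f a) (P : Ideal R) [P.IsPrime]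
    (hP : RingHom.ker f = P) (S : Type w) [CommRing S] [Algebra R S] [IsLocalization.AtPrime S P]
    [IsLocalRing S] {n : ℕ} {x : R} (hx : algebraMap R S x ∈ maximalIdeal S ^ n) :
    x ∈ maximalIdeal R ^ n := by
  classical
  letI : Algebra R W := f.toAlgebra
  have halgW : algebraMap R W = f := RingHom.algebraMap_toAlgebra f
  haveI : Module.Finite R W := hfin
  haveI : IsNoetherian R W := isNoetherian_of_isNoetherianRing_of_finite R W
  -- the statement proved by Noetherian induction on the image `f'(R') ⊆ W`
  suffices key : ∀ N : Submodule R W, ∀ (R' : Type u) [CommRing R'] [IsRegularLocalRing R']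
      (f' : R' →+* W) [IsLocalHom f'] (φ₀ : R →+* R'), f'.comp φ₀ = f →
      (N : Set W) = Set.range f' → ∀ (P' : Ideal R') [P'.IsPrime], RingHom.ker f' = P' →
      ∀ (S' : Type w) [CommRing S'] [Algebra R' S'] [IsLocalization.AtPrime S' P']
        [IsLocalRing S'] (n : ℕ) (x : R'),
        algebraMap R' S' x ∈ maximalIdeal S' ^ n → x ∈ maximalIdeal R' ^ n by
    let N : Submodule R W :=
      { carrier := Set.range f
        add_mem' := by rintro _ _ ⟨a, rfl⟩ ⟨b, rfl⟩; exact ⟨a + b, map_add _ _ _⟩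
        zero_mem' := ⟨0, map_zero _⟩
        smul_mem' := by
          rintro r _ ⟨a, rfl⟩
          exact ⟨r * a, by rw [map_mul, Algebra.smul_def, halgW]⟩ }
    exact key N R f (RingHom.id R) (f.comp_id) rfl P hP S n x hx
  intro N
  induction N using IsNoetherian.induction with
  | hgt N ih =>
  intro R' _ _ f' _ φ₀ hcomp hN P' _ hP' S' _ _ _ _ n x hx
  haveI : IsDomain R' := isDomain_of_isRegularLocalRing R'
  have hbir' : ∀ w : W, ∃ a b : R', f' b ≠ 0 ∧ w * f' b = f' a := birational_of_comp hcomp hbir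
  by_cases hsurj : Function.Surjective f'
  · -- terminal case: `R'/ker f' ≅ W` is regular
    haveI : IsRegularLocalRing (R' ⧸ P') :=
      IsRegularLocalRing.of_ringEquiv
        ((Ideal.quotEquivOfEq hP'.symm).trans (RingHom.quotientKerEquivOfSurjective hsurj)).symm
    have h := le_maximalIdeal_pow_of_map_le_of_isRegularLocalRing_quotient P' S'
      (J := Ideal.span {x}) (n := n) (by
        rw [Ideal.map_span, Set.image_singleton, Ideal.span_le, Set.singleton_subset_iff]
        exact hx)
    exact h (Ideal.subset_span rfl)
  -- otherwise: blow up the closed point and follow the branch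
  by_contra hxn
  obtain ⟨d, hd, c, hc⟩ : ∃ d, (maximalIdeal R').spanFinrank = d ∧
      ∃ c : Fin d → R', Ideal.span (Set.range c) = maximalIdeal R' :=
    ⟨_, rfl, exists_regularSystemOfParameters⟩
  have hcm : ∀ l, c l ∈ maximalIdeal R' := mem_maximalIdeal_of_rsop c hc
  -- some parameter survives in `W`
  have hex : ∃ l, f' (c l) ≠ 0 := by
    by_contra h
    push Not at h
    exact hsurj (surjective_of_forall_map_eq_zero f' hc h hbir')
  obtain ⟨l₀, hl₀⟩ := hex
  -- `j` with `v(f' c_j)` minimal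
  obtain ⟨j, -, hjmin⟩ := Finset.exists_min_image Finset.univ
    (fun l => IsDiscreteValuationRing.addVal W (f' (c l))) ⟨l₀, Finset.mem_univ _⟩
  have hj0 : f' (c j) ≠ 0 := by
    intro h0
    have := hjmin l₀ (Finset.mem_univ _)
    rw [h0, IsDiscreteValuationRing.addVal_zero, top_le_iff,
      IsDiscreteValuationRing.addVal_eq_top_iff] at this
    exact hl₀ this
  have hcj : c j ≠ 0 := fun h0 => hj0 (by rw [h0, map_zero])
  have hdvd : ∀ l, f' (c j) ∣ f' (c l) := fun l =>
    IsDiscreteValuationRing.addVal_le_iff_dvd.mp (hjmin l (Finset.mem_univ _))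
  choose q hq using hdvd
  -- some quotient `q l = f'(c_l)/f'(c_j)` is new
  have hnew : ∃ l, q l ∉ Set.range f' := by
    by_contra h
    push Not at h
    refine hsurj (surjective_of_forall_dvd f' hc (hcm j) hj0 (fun l => ?_) hbir')
    obtain ⟨r, hr⟩ := h l
    exact ⟨r, by rw [hr]; exact hq l⟩
  obtain ⟨l₁, hl₁⟩ := hnew
  -- the chart `B_j` and the lift `g : B_j → W` of `f'`
  set ιW : W →+* FractionRing W := algebraMap W (FractionRing W) with hιW
  have hιWinj : Function.Injective ιW := IsFractionRing.injective W (FractionRing W)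
  have hunitW : IsUnit ((ιW.comp f') (c j)) :=
    isUnit_iff_ne_zero.mpr fun h0 => hj0 (hιWinj (by rw [map_zero]; exact h0))
  obtain ⟨g, hgφ, hge, hgι⟩ := exists_ringHom_chartRing c j f' ιW hιWinj hunitW
    (fun l => ⟨q l, hq l⟩)
  have hgφ' : ∀ r, g (chartBase c j r) = f' r := fun r => RingHom.congr_fun hgφ r
  have hgq : ∀ l, g (chartGen c j l) = q l := fun l =>
    mul_left_cancel₀ hj0 (by rw [hge l, hq l])
  -- the centre `𝔴` of `W` on the chart, the local ring `R₁ = (B_j)_𝔴` and the branch `f₁`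
  obtain ⟨𝔴, h𝔴def⟩ : ∃ 𝔴 : Ideal (chartRing c j), 𝔴 = (maximalIdeal W).comap g := ⟨_, rfl⟩
  haveI h𝔴p : 𝔴.IsPrime := h𝔴def ▸ Ideal.comap_isPrime g (maximalIdeal W)
  obtain ⟨f₁, hf₁loc, hf₁a0⟩ := exists_localHom_localization_comap (W := W) g 𝔴 h𝔴def
  obtain ⟨ι₁, hι₁⟩ : ∃ ι₁ : chartRing c j →+* Localization.AtPrime 𝔴,
      ι₁ = algebraMap (chartRing c j) (Localization.AtPrime 𝔴) := ⟨_, rfl⟩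
  have hf₁a : ∀ b, f₁ (ι₁ b) = g b := fun b => by rw [hι₁]; exact hf₁a0 b
  have h𝔴c : chartBase c j (c j) ∈ 𝔴 := by
    rw [h𝔴def, Ideal.mem_comap, hgφ', mem_maximalIdeal, mem_nonunits_iff, isUnit_map_iff]
    exact hcm j
  -- regularity of the chart and of `R₁`
  haveI : IsRegularRing R' :=
    isRegularRing_iff.mpr fun p _ => isRegularLocalRing_localization_atPrime R' p
  haveI : IsRegularRing (R' ⧸ Ideal.span (Set.range c)) := by
    have hreg : IsRegularLocalRing
        (R' ⧸ Ideal.span (c '' ((Finset.univ : Finset (Fin d)) : Set (Fin d)))) :=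
      isRegularLocalRing_quotient_span_image hd c hc Finset.univ
    rw [Finset.coe_univ, Set.image_univ] at hreg
    exact isRegularRing_iff.mpr fun p _ => isRegularLocalRing_localization_atPrime _ p
  haveI hBreg : IsRegularRing (chartRing c j) :=
    isRegularRing_blowupChart c j (isQuasiRegular_regularSystemOfParameters hd c hc)
  haveI : IsRegularLocalRing (Localization.AtPrime 𝔴) := inferInstance
  haveI : IsLocalHom f₁ := hf₁loc
  have hcomp₁ : f₁.comp ((ι₁.comp (chartBase c j)).comp φ₀) = f := by
    ext r
    simp only [RingHom.comp_apply]
    rw [hf₁a, hgφ', ← RingHom.comp_apply, hcomp]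
  -- the new image is strictly larger
  obtain ⟨N₁, hN₁⟩ : ∃ N₁ : Submodule R W, (N₁ : Set W) = Set.range f₁ :=
    ⟨{ carrier := Set.range f₁
       add_mem' := by rintro _ _ ⟨a, rfl⟩ ⟨b, rfl⟩; exact ⟨a + b, map_add _ _ _⟩
       zero_mem' := ⟨0, map_zero _⟩
       smul_mem' := by
         rintro r _ ⟨a, rfl⟩
         refine ⟨ι₁ (chartBase c j (φ₀ r)) * a, ?_⟩
         rw [map_mul, hf₁a, hgφ', ← RingHom.comp_apply, hcomp, Algebra.smul_def, halgW] }, rfl⟩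
  have hNN₁ : N < N₁ := by
    rw [lt_iff_le_and_ne]
    constructor
    · intro w hw
      have hw' : w ∈ (N : Set W) := hw
      rw [hN] at hw'
      obtain ⟨r, rfl⟩ := hw'
      have : f₁ (ι₁ (chartBase c j r)) ∈ (N₁ : Set W) := by rw [hN₁]; exact ⟨_, rfl⟩
      rw [hf₁a, hgφ'] at this
      exact this
    · intro heq
      apply hl₁
      have : q l₁ ∈ (N₁ : Set W) := by rw [hN₁]; exact ⟨ι₁ (chartGen c j l₁), by rw [hf₁a, hgq]⟩
      rw [← heq, hN] at this
      exact this
  -- `S'` is the localisation of `R₁` at `ker f₁`: the map `h : B_j → S'`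
  have hker : ∀ r, r ∈ P' ↔ f' r = 0 := fun r => by rw [← hP', RingHom.mem_ker]
  have hcjP : c j ∈ P'.primeCompl := fun h => hj0 ((hker _).mp h)
  have hunitS : IsUnit (((RingHom.id S').comp (algebraMap R' S')) (c j)) :=
    IsLocalization.map_units S' ⟨c j, hcjP⟩
  obtain ⟨h, hhφ, -, hhι⟩ := exists_ringHom_chartRing c j (algebraMap R' S') (RingHom.id S')
    Function.injective_id hunitS (fun l => hunitS.dvd)
  have hhφ' : ∀ r, h (chartBase c j r) = algebraMap R' S' r := fun r => RingHom.congr_fun hhφ r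
  have hRS : Function.Injective (algebraMap R' S') :=
    IsLocalization.injective (M := P'.primeCompl) S' (Ideal.primeCompl_le_nonZeroDivisors P')
  haveI : IsDomain S' := IsLocalization.isDomain_of_le_nonZeroDivisors (M := P'.primeCompl)
    S' (Ideal.primeCompl_le_nonZeroDivisors P')
  have hhinj : Function.Injective h := chartLift_injective c j hcj hRS h hunitS hhι
  -- comparison `σ : S' → Frac W`, `σ ∘ h = ιW ∘ g`, so `h b` is a unit whenever `g b ≠ 0`
  have hunitsσ : ∀ t : P'.primeCompl, IsUnit ((ιW.comp f') t) := fun t =>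
    isUnit_iff_ne_zero.mpr fun h0 => t.2 ((hker _).mpr (hιWinj (by rw [map_zero]; exact h0)))
  obtain ⟨σ, hσa⟩ : ∃ σ : S' →+* FractionRing W, ∀ r, σ (algebraMap R' S' r) = ιW (f' r) :=
    ⟨IsLocalization.lift (M := P'.primeCompl) hunitsσ, fun r =>
      IsLocalization.lift_eq hunitsσ r⟩
  have hσh : σ.comp h = ιW.comp g :=
    comp_eq_of_chartLift c j g h ιW σ hunitW hunitS hgι hhι (RingHom.ext hσa)
  have hσ𝔪 : ∀ z ∈ maximalIdeal S', σ z = 0 := by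
    intro z hz
    rw [← IsLocalization.AtPrime.map_eq_maximalIdeal P' S'] at hz
    refine Submodule.span_induction (p := fun z _ => σ z = 0) ?_ (map_zero σ) ?_ ?_ hz
    · rintro _ ⟨p, hp, rfl⟩
      rw [hσa, (hker p).mp hp, map_zero]
    · intro a b _ _ ha hb; rw [map_add, ha, hb, add_zero]
    · intro a b _ hb; rw [smul_eq_mul, map_mul, hb, mul_zero]
  have hhu : ∀ b, g b ≠ 0 → IsUnit (h b) := by
    intro b hb
    by_contra hu
    have h1 : σ (h b) = 0 := hσ𝔪 _ ((mem_maximalIdeal _).mpr (mem_nonunits_iff.mpr hu))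
    rw [← RingHom.comp_apply, hσh, RingHom.comp_apply] at h1
    exact hb (hιWinj (by rw [map_zero]; exact h1))
  have hsurjS : ∀ z : S', ∃ r t : chartRing c j, g t ≠ 0 ∧ z * h t = h r := by
    intro z
    obtain ⟨⟨r, t⟩, hz⟩ := IsLocalization.surj P'.primeCompl z
    refine ⟨chartBase c j r, chartBase c j t, ?_, ?_⟩
    · rw [hgφ']; exact fun h0 => t.2 ((hker _).mpr h0)
    · rw [hhφ', hhφ']; exact hz
  haveI : IsDomain (chartRing c j) := hhinj.isDomain h
  haveI hP₁ : (RingHom.ker f₁).IsPrime := RingHom.ker_isPrime f₁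
  obtain ⟨h₁, hh₁a, hloc⟩ :=
    exists_isLocalization_of_chart (W := W) g 𝔴 h𝔴def f₁ hf₁a0 h hhinj hhu hsurjS _ rfl
  letI algS : Algebra (Localization.AtPrime 𝔴) S' := h₁.toAlgebra
  haveI : IsLocalization.AtPrime S' (RingHom.ker f₁) := hloc
  have halg : ∀ z, algebraMap (Localization.AtPrime 𝔴) S' z = h₁ z := fun z => rfl
  have hh₁a' : ∀ b, h₁ (ι₁ b) = h b := fun b => by rw [hι₁]; exact hh₁a b
  -- the order of `x`: `x ∈ 𝔪'^ν ∖ 𝔪'^(ν+1)` with `ν < n`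
  have hexk : ∃ k, x ∉ maximalIdeal R' ^ k := ⟨n, hxn⟩
  set k₀ := Nat.find hexk with hk₀def
  have hk₀ : x ∉ maximalIdeal R' ^ k₀ := Nat.find_spec hexk
  have hk₀n : k₀ ≤ n := Nat.find_min' hexk hxn
  have hk₀0 : k₀ ≠ 0 := by
    intro h0; rw [h0, pow_zero, Ideal.one_eq_top] at hk₀; exact hk₀ trivial
  obtain ⟨ν, hν⟩ : ∃ ν, k₀ = ν + 1 := Nat.exists_eq_succ_of_ne_zero hk₀0
  have hxν : x ∈ maximalIdeal R' ^ ν := by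
    have := Nat.find_min hexk (m := ν) (by rw [← hk₀def, hν]; exact Nat.lt_succ_self ν)
    exact not_not.mp this
  have hxν' : x ∉ maximalIdeal R' ^ (ν + 1) := hν ▸ hk₀
  -- the weak transform `x'` of `x` on the chart and its order at `𝔴`
  obtain ⟨x', hx', hx'ν⟩ := exists_weakTransform_chart_not_mem_pow hd c hc j hxν hxν' 𝔴 h𝔴c
  rw [← hι₁] at hx'ν
  -- `x'/1 ∈ (P S')^n`, since `x = c_j^ν x'` and `c_j` is a unit of `S'`
  have hx'S : algebraMap (Localization.AtPrime 𝔴) S' (ι₁ x') ∈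
      maximalIdeal S' ^ n := by
    rw [halg, hh₁a']
    have h1 : algebraMap R' S' x = algebraMap R' S' (c j) ^ ν * h x' := by
      have hp : h (chartBase c j (c j) ^ ν) = algebraMap R' S' (c j) ^ ν := by
        rw [← hhφ']; exact map_pow h _ ν
      have := congrArg h hx'
      rw [map_mul, hhφ', hp] at this
      exact this
    obtain ⟨u, hu⟩ := hunitS
    have hu' : (u : S') = algebraMap R' S' (c j) := hu
    have h2 : h x' = ↑(u⁻¹ ^ ν) * algebraMap R' S' x := by
      rw [h1, ← hu', ← mul_assoc, Units.val_pow_eq_pow_val, ← mul_pow, Units.inv_mul, one_pow,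
        one_mul]
    rw [h2]
    exact Ideal.mul_mem_left _ _ hx
  have IH := ih N₁ hNN₁ (Localization.AtPrime 𝔴) f₁ ((ι₁.comp (chartBase c j)).comp φ₀) hcomp₁
    hN₁ _ rfl S' n (ι₁ x') hx'S
  exact hx'ν (Ideal.pow_le_pow_right (by omega) IH)

/-- **The order along a branch is at most the order at the point** (ideal form): with notation as
in `mem_pow_of_algebraMap_mem_pow_of_branch`, `J S ⊆ (PS)^n ⇒ J ⊆ 𝔪^n`, i.e.
`ord_P J ≤ ord_𝔪 J` for the prime `P = ker f` of a branch. [cite: CossartPiltant2008, Prop. 4.2 (proof)] -/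
theorem le_pow_of_map_le_pow_of_branch (f : R →+* W) [IsLocalHom f] (hfin : f.Finite)
    (hbir : ∀ w : W, ∃ a b : R, f b ≠ 0 ∧ w * f b = f a) (P : Ideal R) [P.IsPrime]
    (hP : RingHom.ker f = P) (S : Type w) [CommRing S] [Algebra R S] [IsLocalization.AtPrime S P]
    [IsLocalRing S] {n : ℕ} {J : Ideal R} (hJ : J.map (algebraMap R S) ≤ maximalIdeal S ^ n) :
    J ≤ maximalIdeal R ^ n := fun _ hx =>
  mem_pow_of_algebraMap_mem_pow_of_branch f hfin hbir P hP S (hJ (Ideal.mem_map_of_mem _ hx))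

end Branch

end Literature.AlgebraicGeometry.Resolution

end
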